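/-
Copyright (c) 2026 the pub-hodgecm-mathlib formalisation cell (harness21).  Prover seat hodgecm-mathlib-K2E1-p16 (g2), Track B ∕ K2-LIT, h413 = `stmt-HodgeConjecture-24833`,
R90-TF section S8 «ContSpec-n½» (dealer R90-CS-plan (g0), LEAD K2E1-plan (g7)), hand p08 «R6-orth», SIBLING of ★ p861668 `K2E1ChiPseudoEisensteinFamiliesOrthogonalCMTwo`:
the consumer-side discharge of the two «not a norm twist» letters for RAY-TRIVIAL characters (plain `χ ≠ χ′`, `χ ≠ χ′ʷ`), as the S8B#4 assembly wants them.
-/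
import Summits.HodgeConjecture.HodgeConjecture.Theorems.K2E1ChiPseudoEisensteinFamiliesOrthogonalCMTwo   -- ★ p861668 (this seat): `isOrtho_topologicalClosure_span_family_of_not_isNormTwist`
import Summits.HodgeConjecture.HodgeConjecture.Theorems.K2E1FamilyIndexSplitSelfDualU2                      -- ★ (K2E1-p12): `eq_reflectChar_of_isNormTwist_of_rayTrivial` pattern; ★ `reflectChar_posRealIdele`, Tate §4.3 bricks
import HarnessLib

/-!
# `K2E1ChiPseudoEisensteinFamiliesOrthogonalRayTrivialCMTwo` — BLOCK ORTHOGONALITY WITH PLAIN `≠` HYPOTHESES FOR RAY-TRIVIAL `χ, χ′`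
# (ROAD-S8B2 row R6 in the currency of the C7 family index `S_ω(K′) = {χ ray-trivial, V(χ,K′,ω) ≠ ⊥}`)

Track B ∕ K2-LIT, crux h413 = `stmt-HodgeConjecture-24833`; R90-TF section S8, hand p08 (R90-CS-plan 16:03:38Z «GO the corollary with plain `χ ≠ χ′, χ′ ≠ χʷ` for ray-trivial
characters — the #4 assembly wants plain `≠`»).  THEOREMS ONLY; lane `--supports stmt-HodgeConjecture-24833 --as helper` (count-neutral).

The blocks of ★ C7 HEAD″ (p861008 :268) are indexed by RAY-TRIVIAL Hecke characters `χ` (`∀ r, χ (posRealIdele L r) = 1`: the normalisation that kills the `‖·‖^{s}`-ambiguity of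
the cuspidal datum).  For two ray-trivial characters «`χ·χ′⁻¹` is a norm twist» already forces `χ = χ′` (Tate §4.3: a norm twist trivial on the positive real ray is trivial on
`𝕀¹_L · ρ(ℝ_{>0}) = 𝕀_L`), and `χ′ʷ = reflectChar c χ′` is again ray-trivial (★ `reflectChar_posRealIdele`).  Hence:
* §1 **`eq_of_isNormTwist_mul_inv_of_rayTrivial`** — ray-trivial `χ, χ′` with `(χ·χ′⁻¹).IsNormTwist` are EQUAL (two-character edition of ★
  `K2E1FamilyIndexSplitSelfDualU2.eq_reflectChar_of_isNormTwist_of_rayTrivial`, same proof); `not_isNormTwist_mul_inv_of_rayTrivial_of_ne`,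
  `not_isNormTwist_mul_inv_reflectChar_of_rayTrivial_of_ne'` (the two letters of ★ p861668 from `χ ≠ χ′`, `χ ≠ χ′ʷ`).
* §2 HEAD **`isOrtho_topologicalClosure_span_family_of_rayTrivial_of_ne`** — ★ p861668 `isOrtho_topologicalClosure_span_family_of_not_isNormTwist` with its two norm-twist
  letters DISCHARGED: for unitary RAY-TRIVIAL `χ ≠ χ′` with `χ ≠ χ′ʷ`, the closed blocks `closure span(family_ω χ)` and `closure span(family_ω χ′)` of `L²(𝔛, μ)` are orthogonal
  (generator sets = p861008 :268 verbatim; remaining letters: (XF)'s structural Haar ∕ fundamental-domain data and the two `hχb` bounds).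
[MoeglinWaldspurger1995 II.2.1; TateThesis1967 §4.3.]  HONEST LABEL: HC_CM is proved only modulo the 7 printed citations (2 remaining named inputs: hLiu418 =
`stmt-HodgeConjecture-24832`, h413 = `stmt-HodgeConjecture-24833`) until rung 0 closes; this file asserts no named fact and closes no socket; count-neutral.

## References
* [MoeglinWaldspurger1995] C. Mœglin, J.-L. Waldspurger, *Spectral decomposition and Eisenstein series* (1995), II.2.1.
* [TateThesis1967] J. Tate, *Fourier analysis in number fields and Hecke's zeta-functions*, in Cassels–Fröhlich (1967), §4.3, Thm. 4.4.1.
-/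

set_option autoImplicit false
set_option linter.dupNamespace false  -- the mandated namespace repeats the summit's segment (`HodgeConjecture.HodgeConjecture`)

noncomputable section

open MeasureTheory Measure Set Filter Topology NumberField IsDedekindDomain
open scoped NNReal ENNReal InnerProductSpace
open Literature.NumberTheory.Automorphic Literature.NumberTheory.Automorphic.UnitaryGroup AdelicGroupData Literature.NumberTheory.GaloisRepresentations
open Summit.HodgeConjecture.HodgeConjecture.Cruxes.H413.K2E1BorelEisensteinU
open Summit.HodgeConjecture.HodgeConjecture.Cruxes.H413.K2E1CharacterEisensteinU2Defs
open Summit.HodgeConjecture.HodgeConjecture.Cruxes.H413.K2E1ChiSectionSpaceU2Defs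
open Summit.HodgeConjecture.HodgeConjecture.Cruxes.H413.K2E1ChiMaassSelbergCMTwo (reflectChar_posRealIdele)
open Summit.HodgeConjecture.HodgeConjecture.Cruxes.H413.K2E1ChiPseudoEisensteinFamiliesOrthogonalCMTwo (isOrtho_topologicalClosure_span_family_of_not_isNormTwist)

namespace Summit.HodgeConjecture.HodgeConjecture.Cruxes.H413.K2E1ChiPseudoEisensteinFamiliesOrthogonalRayTrivialCMTwo

/-! ## §1 Ray-trivial characters: «norm twist» collapses to equality -/

section RayTrivial

variable {F E : Type} [Field F] [Field E] [NumberField E] [Algebra F E] {c : E ≃ₐ[F] E}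

/-- **TWO RAY-TRIVIAL HECKE CHARACTERS WHOSE QUOTIENT IS A NORM TWIST ARE EQUAL**: `ψ = χ·χ′⁻¹` is ray-trivial and kills `𝕀¹_E` (Tate §4.3, ★
`HeckeCharacter.isNormTwist_iff_forall_mem_normOneIdeles`); `𝕀_E = 𝕀¹_E · ρ(ℝ_{>0})` (★ `exists_normOneIdeles_mul_posRealIdele`) ⇒ `ψ = 1`.  Two-character edition of ★
`K2E1FamilyIndexSplitSelfDualU2.eq_reflectChar_of_isNormTwist_of_rayTrivial`. [cite: TateThesis1967, §4.3 (remark before §4.4)] -/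
theorem eq_of_isNormTwist_mul_inv_of_rayTrivial {χ χ' : HeckeCharacter E} (hray : ∀ r : ℝ≥0ˣ, χ (posRealIdele E r) = 1)
    (hray' : ∀ r : ℝ≥0ˣ, χ' (posRealIdele E r) = 1) (hnt : (χ * χ'⁻¹).IsNormTwist) : χ = χ' := by
  have h1 : ∀ x ∈ normOneIdeles E, (χ * χ'⁻¹) x = 1 := (HeckeCharacter.isNormTwist_iff_forall_mem_normOneIdeles _).1 hnt
  have hψ : χ * χ'⁻¹ = 1 := by
    refine HeckeCharacter.ext fun x => ?_
    obtain ⟨y, hy, r, rfl⟩ := exists_normOneIdeles_mul_posRealIdele E x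
    rw [map_mul, h1 y hy, one_mul, HeckeCharacter.one_apply, HeckeCharacter.mul_apply, HeckeCharacter.inv_apply, hray r, hray' r, inv_one, mul_one]
  exact mul_inv_eq_one.1 hψ

/-- Ray-trivial `χ ≠ χ′` ⇒ `χ·χ′⁻¹` is NOT a norm twist (the letter `h₁` of ★ p861668). [cite: TateThesis1967, §4.3] -/
theorem not_isNormTwist_mul_inv_of_rayTrivial_of_ne {χ χ' : HeckeCharacter E} (hray : ∀ r : ℝ≥0ˣ, χ (posRealIdele E r) = 1)
    (hray' : ∀ r : ℝ≥0ˣ, χ' (posRealIdele E r) = 1) (hne : χ ≠ χ') : ¬ (χ * χ'⁻¹).IsNormTwist :=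
  fun hnt => hne (eq_of_isNormTwist_mul_inv_of_rayTrivial hray hray' hnt)

/-- Ray-trivial `χ ≠ χ′ʷ` ⇒ `χ·(χ′ʷ)⁻¹` is NOT a norm twist (the letter `h₂` of ★ p861668; `χ′ʷ = reflectChar c χ′` is ray-trivial by ★ `reflectChar_posRealIdele`).
[cite: TateThesis1967, §4.3] [cite: MoeglinWaldspurger1995, II.2.1] -/
theorem not_isNormTwist_mul_inv_reflectChar_of_rayTrivial_of_ne' {χ χ' : HeckeCharacter E} (hray : ∀ r : ℝ≥0ˣ, χ (posRealIdele E r) = 1)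
    (hray' : ∀ r : ℝ≥0ˣ, χ' (posRealIdele E r) = 1) (hne : χ ≠ reflectChar c χ') : ¬ (χ * (reflectChar c χ')⁻¹).IsNormTwist :=
  not_isNormTwist_mul_inv_of_rayTrivial_of_ne hray (reflectChar_posRealIdele (c := c) hray') hne

end RayTrivial

/-! ## §2 HEAD: block orthogonality for ray-trivial `χ ≠ χ′`, `χ ≠ χ′ʷ` -/

section CM

variable (L : Type) [Field L] [NumberField L] [IsCMField L]
  [MeasurableSpace (quasiSplit (↥(maximalRealSubfield L)) L (IsCMField.complexConj L) 2).Adelic] [BorelSpace (quasiSplit (↥(maximalRealSubfield L)) L (IsCMField.complexConj L) 2).Adelic]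
  [MeasurableSpace (AdeleRing (𝓞 L) L)ˣ] [BorelSpace (AdeleRing (𝓞 L) L)ˣ]

/-- **ROAD-S8B2 ROW R6 IN THE FAMILY-INDEX CURRENCY**: for UNITARY, RAY-TRIVIAL Hecke characters `χ ≠ χ′` with `χ ≠ χ′ʷ` (`χ′ʷ = reflectChar c χ′`) — i.e. two distinct,
non-`w`-conjugate members of the C7 index `S_ω(K′)` — the closed blocks `closure span(family_ω χ) ⟂ closure span(family_ω χ′)` in `L²(𝔛, μ)` (★ p861668
`isOrtho_topologicalClosure_span_family_of_not_isNormTwist` with `h₁ h₂` discharged by §1; generator sets = ★ p861008 :268 verbatim; remaining letters = (XF)'s structural Haar ∕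
fundamental-domain data `νG μK νI 𝓕I ν 𝓕` and the bounded-section letters `hχb hχ'b`). [cite: MoeglinWaldspurger1995, II.2.1] [cite: TateThesis1967, §4.3 and Thm. 4.4.1] -/
theorem isOrtho_topologicalClosure_span_family_of_rayTrivial_of_ne
    (μ : Measure (quasiSplit (↥(maximalRealSubfield L)) L (IsCMField.complexConj L) 2).automorphicQuotient) [(quasiSplit (↥(maximalRealSubfield L)) L (IsCMField.complexConj L) 2).IsAutomorphicMeasure μ]
    (νG : Measure (quasiSplit (↥(maximalRealSubfield L)) L (IsCMField.complexConj L) 2).Adelic) [νG.IsHaarMeasure] [νG.IsInvInvariant]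
    (μK : Measure ((standardMaximalCompactGL 2 L).comap (adelicVal (↥(maximalRealSubfield L)) L (IsCMField.complexConj L) 2 ((StdForm.antidiagonal 2).over L)) : Subgroup (quasiSplit (↥(maximalRealSubfield L)) L (IsCMField.complexConj L) 2).Adelic)) [μK.IsHaarMeasure]
    (νI : Measure (AdeleRing (𝓞 L) L)ˣ) [νI.IsHaarMeasure]
    {𝓕I : Set (AdeleRing (𝓞 L) L)ˣ} (h𝓕I : IsIdeleClassDomain L 𝓕I)
    (ν : Measure ↥(adelicUnipotent (↥(maximalRealSubfield L)) L (IsCMField.complexConj L) 2)) [ν.IsHaarMeasure] {𝓕 : Set ↥(adelicUnipotent (↥(maximalRealSubfield L)) L (IsCMField.complexConj L) 2)}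
    (h𝓕N : IsFundamentalDomain ↥(rationalUnipotent (↥(maximalRealSubfield L)) L (IsCMField.complexConj L) 2) 𝓕 ν) (h𝓕c : IsCompact (closure 𝓕)) (h𝓕₀ : ν 𝓕 ≠ 0)
    (K' : Subgroup (quasiSplit (↥(maximalRealSubfield L)) L (IsCMField.complexConj L) 2).Adelic) (ω : ↥K' → ℂ)
    {χ χ' : HeckeCharacter L} (hχu : χ.IsUnitary) (hχ'u : χ'.IsUnitary)
    (hray : ∀ r : ℝ≥0ˣ, χ (posRealIdele L r) = 1) (hray' : ∀ r : ℝ≥0ˣ, χ' (posRealIdele L r) = 1)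
    (hne : χ ≠ χ') (hnew : χ ≠ reflectChar (IsCMField.complexConj L) χ')
    (hχb : ∀ φ : (quasiSplit (↥(maximalRealSubfield L)) L (IsCMField.complexConj L) 2).Adelic → ℂ, φ ∈ chiSectionSpace χ K' ω → Continuous φ → ∃ M : ℝ, ∀ g, ‖φ g‖ ≤ M)
    (hχ'b : ∀ φ : (quasiSplit (↥(maximalRealSubfield L)) L (IsCMField.complexConj L) 2).Adelic → ℂ, φ ∈ chiSectionSpace χ' K' ω → Continuous φ → ∃ M : ℝ, ∀ g, ‖φ g‖ ≤ M) :
    (Submodule.span ℂ {v : (quasiSplit (↥(maximalRealSubfield L)) L (IsCMField.complexConj L) 2).L2 μ |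
        ∃ (f : ℝ → ℂ) (_ : Continuous f) (_ : HasCompactSupport f) (_ : tsupport f ⊆ Ioi 0)
          (φ : (quasiSplit (↥(maximalRealSubfield L)) L (IsCMField.complexConj L) 2).Adelic → ℂ) (_ : φ ∈ chiSectionSpace χ K' ω) (_ : Continuous φ)
          (hv : MemLp ((quasiSplit (↥(maximalRealSubfield L)) L (IsCMField.complexConj L) 2).quotFun (eisensteinSeriesU (fun g => f (borelHeight g) * φ g))) 2 μ), v = hv.toLp _}).topologicalClosure ⟂
    (Submodule.span ℂ {v : (quasiSplit (↥(maximalRealSubfield L)) L (IsCMField.complexConj L) 2).L2 μ |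
        ∃ (f : ℝ → ℂ) (_ : Continuous f) (_ : HasCompactSupport f) (_ : tsupport f ⊆ Ioi 0)
          (φ : (quasiSplit (↥(maximalRealSubfield L)) L (IsCMField.complexConj L) 2).Adelic → ℂ) (_ : φ ∈ chiSectionSpace χ' K' ω) (_ : Continuous φ)
          (hv : MemLp ((quasiSplit (↥(maximalRealSubfield L)) L (IsCMField.complexConj L) 2).quotFun (eisensteinSeriesU (fun g => f (borelHeight g) * φ g))) 2 μ), v = hv.toLp _}).topologicalClosure :=
  isOrtho_topologicalClosure_span_family_of_not_isNormTwist L μ νG μK νI h𝓕I ν h𝓕N h𝓕c h𝓕₀ K' ω hχu hχ'u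
    (not_isNormTwist_mul_inv_of_rayTrivial_of_ne hray hray' hne)
    (not_isNormTwist_mul_inv_reflectChar_of_rayTrivial_of_ne' hray hray' hnew) hχb hχ'b

end CM

end Summit.HodgeConjecture.HodgeConjecture.Cruxes.H413.K2E1ChiPseudoEisensteinFamiliesOrthogonalRayTrivialCMTwo

end
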